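import Summits.PneNP.PneNP.Theorems.ChebyshevTracialDesignCrossingPlaneReduction
import Summits.PneNP.PneNP.Theorems.ChebyshevTracialDesignVirtualPositivityCriterion
import HarnessLib

/-!
# Cell pnp-psdrank, route `ChebyshevTracialDesign`: (CG_1′) IN THE CROSSING PLANE, CONDITIONAL ON BULK RELATIVE LEVEL-SMOOTHNESS —
# brick 120 (crossing-plane reduction) ∘ brick 121 (virtual-positivity criterion) (crux `TracialDecayExp20`, stmt-PneNP-19878)

Brick 122 (prover g23; MEMO-26 §1, §7). Brick 120 `abs_crossingPlane_value_add_newton_le`: per matching `M`, block `H`, any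
profile `|ψ| ≤ G`, crossing-plane direction `(λ, κ)`: `| V + N^odd_D[φ₀](0) | ≤ R` (`V` = `|PM|`·(tilted (CG_1′) value), `φ₀(c) =
E_{Shell_c(M)}[ψ(X)(2λX+κt)²]`, `R` = seven pure remainders). Brick 121 `shellProfile_newton_eval_zero_ge`: for `0 ≤ ψ₀ ≤ G₀` and a window
`B` of relatively level-smooth points, `N^odd_D[φ₀](0) ≥ −2^{D+1}·G₀·(tail mass outside B)`. With `ψ ≥ 0`, `ψ₀(x) = ψ(x)(2λx+κt)² ∈ [0, 9t²G]` on
`[0,t]`, hence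

* **`crossingPlane_value_le_of_relSmooth`**: under the hypotheses of brick 120 plus `ψ ≥ 0` on `[0,t]` and the bulk relative
  level-smoothness of the shell laws `law_c(x) = shellLaw π univ H t c x` on a window `B ⊆ [0,t]`,
  `V ≤ R + 2^{D+1}·9t²G·Σ_{x∈[0,t]∖B} Σ_{j≤D} law_{2j+1}(x)` — the tilted (CG_1′) value of a nonnegative block statistic in every
  crossing-plane direction is bounded by the seven pure remainders PLUS the tail mass of the `D+1` level laws outside the smooth window.
READING: this is the per-matching (CG_1′) inequality of the block-statistic line in the crossing plane, CONDITIONAL on exactly the two analytic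
inputs named in MEMO-26 §3/§7 ([BULK] = the `hbulk` hypothesis, [TAIL] = the right-hand tail mass); both inputs now have their component lemmas
in the tree (`PoissonBinomialTilting` §6–§11, `PoissonBinomialChernoff`, `ShellLawDeletionComparability`). WHAT THIS FILE DOES NOT DO: discharge
`hbulk` or bound the tail mass (those are the assemblies of MEMO-26 §7); directions outside the crossing plane; anything on `TracialDecayExp20`
itself, psd rank of P_PM(K_n), or P vs NP. [cite: Rothvoss2017, §2 (PDF p. 6)] [cite: Agarwal2000DifferenceEquations, Thm. 1.8.5 (1.8.6), Remark 1.8.1 (1.8.8)]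
[cite: GriblingDelaatLaurent2019, §5]
Stature: support/instrument (kernel lane, no defs, axioms standard). Supports stmt-PneNP-19878.
-/

set_option linter.dupNamespace false -- `Summit.PneNP.PneNP.…`: summit = sub-problem (D-0017)

noncomputable section

namespace Summit.PneNP.PneNP.Theorems.ChebyshevTracialDesignCrossingPlaneConditional

open Finset Polynomial Literature.Barriers.PneNP Literature.Combinatorics.Optimization
open Literature.Combinatorics.Optimization.ShellStep
open Summit.PneNP.PneNP.Theorems.ChebyshevTracialDesignCrossingPlaneReduction (abs_crossingPlane_value_add_newton_le)
open Summit.PneNP.PneNP.Theorems.ChebyshevTracialDesignVirtualPositivityCriterion (shellProfile_newton_eval_zero_ge)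

variable {n : ℕ}

/-- **(CG_1′) in the crossing plane, conditional on bulk relative level-smoothness (brick 122 = brick 120 ∘ brick 121).** Under the
hypotheses of brick 120 with a NONNEGATIVE profile `0 ≤ ψ ≤ G` on `[0,t]` (`t = t₁ + 2(D+1) + 2`), and a window `B ⊆ [0,t]` on which the
shell laws of `|U∩H|` are relatively level-smooth (`Σ_{k=1}^{D}(C(2k,k)/4^k)|Δ^k[j ↦ law_{2j+1}(x)](0)| ≤ law_1(x)`):
`|PM|·Σ_U W(U,M)·ψ(|U∩H|)·(Σ_p u_p x_p x_{πp})² ≤ R + 2^{D+1}·9t²G·Σ_{x∈[0,t]∖B}Σ_{j≤D} law_{2j+1}(x)`, `R` = brick 120's seven remainders.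
[cite: Rothvoss2017, §2 (PDF p. 6)] [cite: Agarwal2000DifferenceEquations, Thm. 1.8.5 (1.8.6), Remark 1.8.1 (1.8.8)] -/
theorem crossingPlane_value_le_of_relSmooth {t₁ T D : ℕ} {Bv : ℝ} {C : Finset ℕ} {w : ℕ → ℝ}
    (hdes : IsExactDesign n (t₁ + 2 * (D + 1) + 2) T D Bv C w) (hDT : 2 * D + 1 ≤ T) (M : PMatch n)
    (H : Finset (Fin n)) (ψ : ℤ → ℝ) {G : ℝ} (hG0 : 0 ≤ G)
    (hG : ∀ x ∈ Icc (0 : ℤ) ((t₁ + 2 * (D + 1) + 2 : ℕ) : ℤ), |ψ x| ≤ G)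
    (lam kap : ℝ) (hlam : |lam| ≤ 1) (hkap : |kap| ≤ 1)
    {m : ℕ} (hm : 3 ≤ m) (hmn : m + 4 * (D + 1) + 4 ≤ n) (X : ℕ → ℝ) (hX0 : ∀ k, 0 ≤ X k)
    (hX : ∀ k, k ≤ D + 1 → ∀ e, e ≤ 2 → ∀ c' : ℕ, c' + 2 * k ≤ T → ∀ S' : Finset (Fin n), (∀ u ∈ S', M.2.partner u ∈ S') →
      S'.card + 4 * k + 2 * e = n →
      ∑ x ∈ Icc (0 : ℤ) ((t₁ + 2 * (D + 1) + 2 - e : ℕ) : ℤ),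
        |nab2^[k] (fun c x => shellLaw M.2.partner S' H (t₁ + 2 * (D + 1) + 2 - e - 2 * k) c x : Profile) c' x| ≤ X k)
    (hψ0 : ∀ x ∈ Icc (0 : ℤ) ((t₁ + 2 * (D + 1) + 2 : ℕ) : ℤ), 0 ≤ ψ x)
    (B : Finset ℤ) (hB : B ⊆ Icc (0 : ℤ) ((t₁ + 2 * (D + 1) + 2 : ℕ) : ℤ))
    (hbulk : ∀ x ∈ B, ∑ k ∈ Ico 1 (D + 1), (((2 * k).choose k : ℕ) : ℝ) / (4 : ℝ) ^ k *
        |(fwdDiff (1 : ℕ))^[k] (fun j => shellLaw M.2.partner univ H (t₁ + 2 * (D + 1) + 2) (2 * j + 1) x) 0| ≤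
          shellLaw M.2.partner univ H (t₁ + 2 * (D + 1) + 2) 1 x) :
    (Fintype.card (PMatch n) : ℝ) * ∑ U : OddSet n, levelWeight n (t₁ + 2 * (D + 1) + 2) C w U M *
        (ψ ((U.1 ∩ H).card : ℤ) *
          (∑ p : Fin n, (lam * ((if (p ∈ H ∧ M.2.partner p ∈ H) then (1 : ℝ) else 0) -
              (if (p ∉ H ∧ M.2.partner p ∉ H) then (1 : ℝ) else 0)) + (lam + kap)) *
            ((if p ∈ U.1 then (1 : ℝ) else 0) * (if M.2.partner p ∈ U.1 then (1 : ℝ) else 0))) ^ 2) ≤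
      (-- R₀
      Bv * ((((T - 1) / 2).choose (D + 1) : ℕ) : ℝ) *
          ((9 * ((t₁ + 2 * (D + 1) + 2 : ℕ) : ℝ) ^ 2 * G) * (((m : ℝ) / (4 * ((m : ℝ) - 2))) ^ (D + 1) * X (D + 1))) +
      -- 2 R₁
      2 * ((2 * (D : ℝ) + 1) * ((((2 * D).choose D : ℕ) : ℝ) / (4 : ℝ) ^ D) *
            ((3 * ((t₁ + 2 * (D + 1) + 2 : ℕ) : ℝ) * G) * (((m : ℝ) / (4 * ((m : ℝ) - 2))) ^ D * X D)) +
          Bv * ((((T - 1) / 2).choose (D + 1) : ℕ) : ℝ) *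
            ((T : ℝ) * ((3 * ((t₁ + 2 * (D + 1) + 2 : ℕ) : ℝ) * G) * (((m : ℝ) / (4 * ((m : ℝ) - 2))) ^ (D + 1) * X (D + 1))) +
              2 * ((D : ℝ) + 1) * ((3 * ((t₁ + 2 * (D + 1) + 2 : ℕ) : ℝ) * G) * (((m : ℝ) / (4 * ((m : ℝ) - 2))) ^ D * X D)))) +
      -- R₂
      ((2 * (D : ℝ) + 1) * ((((2 * D).choose D : ℕ) : ℝ) / (4 : ℝ) ^ D) *
          ((T : ℝ) * (G * (((m : ℝ) / (4 * ((m : ℝ) - 2))) ^ D * X D)) +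
            2 * (D : ℝ) * (G * (((m : ℝ) / (4 * ((m : ℝ) - 2))) ^ (D - 1) * X (D - 1)))) +
        Bv * ((((T - 1) / 2).choose (D + 1) : ℕ) : ℝ) *
          ((T : ℝ) * ((T : ℝ) * (G * (((m : ℝ) / (4 * ((m : ℝ) - 2))) ^ (D + 1) * X (D + 1))) +
              2 * ((D : ℝ) + 1) * (G * (((m : ℝ) / (4 * ((m : ℝ) - 2))) ^ D * X D))) +
            2 * ((D : ℝ) + 1) * ((T : ℝ) * (G * (((m : ℝ) / (4 * ((m : ℝ) - 2))) ^ D * X D)) +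
              2 * (D : ℝ) * (G * (((m : ℝ) / (4 * ((m : ℝ) - 2))) ^ (D - 1) * X (D - 1)))))) +
      -- 4 R₃
      4 * ((2 * (D : ℝ) + 1) * ((((2 * D).choose D : ℕ) : ℝ) / (4 : ℝ) ^ D) *
            (((H.card : ℝ) / n) * ((3 * ((t₁ + 2 * (D + 1) + 2 : ℕ) : ℝ) * G) * (((m : ℝ) / (4 * ((m : ℝ) - 2))) ^ D * X D))) +
          Bv * ((((T - 1) / 2).choose (D + 1) : ℕ) : ℝ) *
            ((T : ℝ) * (((H.card : ℝ) / n) * ((3 * ((t₁ + 2 * (D + 1) + 2 : ℕ) : ℝ) * G) *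
                (((m : ℝ) / (4 * ((m : ℝ) - 2))) ^ (D + 1) * X (D + 1)))) +
              2 * ((D : ℝ) + 1) * (((H.card : ℝ) / n) * ((3 * ((t₁ + 2 * (D + 1) + 2 : ℕ) : ℝ) * G) *
                (((m : ℝ) / (4 * ((m : ℝ) - 2))) ^ D * X D))))) +
      -- 4 R₄
      4 * ((2 * (D : ℝ) + 1) * ((((2 * D).choose D : ℕ) : ℝ) / (4 : ℝ) ^ D) *
            ((T : ℝ) * (((H.card : ℝ) / n) * (G * (((m : ℝ) / (4 * ((m : ℝ) - 2))) ^ D * X D))) +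
              2 * (D : ℝ) * (((H.card : ℝ) / n) * (G * (((m : ℝ) / (4 * ((m : ℝ) - 2))) ^ (D - 1) * X (D - 1))))) +
          Bv * ((((T - 1) / 2).choose (D + 1) : ℕ) : ℝ) *
            ((T : ℝ) * ((T : ℝ) * (((H.card : ℝ) / n) * (G * (((m : ℝ) / (4 * ((m : ℝ) - 2))) ^ (D + 1) * X (D + 1)))) +
                2 * ((D : ℝ) + 1) * (((H.card : ℝ) / n) * (G * (((m : ℝ) / (4 * ((m : ℝ) - 2))) ^ D * X D)))) +
              2 * ((D : ℝ) + 1) * ((T : ℝ) * (((H.card : ℝ) / n) * (G * (((m : ℝ) / (4 * ((m : ℝ) - 2))) ^ D * X D))) +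
                2 * (D : ℝ) * (((H.card : ℝ) / n) * (G * (((m : ℝ) / (4 * ((m : ℝ) - 2))) ^ (D - 1) * X (D - 1))))))) +
      -- 4 R₅
      4 * ((2 * (D : ℝ) + 1) * ((((2 * D).choose D : ℕ) : ℝ) / (4 : ℝ) ^ D) *
            (((H.card : ℝ) / n) * (G * (((m : ℝ) / (4 * ((m : ℝ) - 2))) ^ D * X D))) +
          Bv * ((((T - 1) / 2).choose (D + 1) : ℕ) : ℝ) *
            ((T : ℝ) * (((H.card : ℝ) / n) * (G * (((m : ℝ) / (4 * ((m : ℝ) - 2))) ^ (D + 1) * X (D + 1)))) +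
              2 * ((D : ℝ) + 1) * (((H.card : ℝ) / n) * (G * (((m : ℝ) / (4 * ((m : ℝ) - 2))) ^ D * X D))))) +
      -- 4 R₆
      4 * ((2 * (D : ℝ) + 1) * ((((2 * D).choose D : ℕ) : ℝ) / (4 : ℝ) ^ D) *
            (((H.card : ℝ) ^ 2 / ((n : ℝ) * ((n : ℝ) - 2))) * (G * ((T : ℝ) * (((m : ℝ) / (4 * ((m : ℝ) - 2))) ^ D * X D) +
              2 * (D : ℝ) * (((m : ℝ) / (4 * ((m : ℝ) - 2))) ^ (D - 1) * X (D - 1))))) +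
          Bv * ((((T - 1) / 2).choose (D + 1) : ℕ) : ℝ) *
            ((T : ℝ) * (((H.card : ℝ) ^ 2 / ((n : ℝ) * ((n : ℝ) - 2))) *
                (G * ((T : ℝ) * (((m : ℝ) / (4 * ((m : ℝ) - 2))) ^ (D + 1) * X (D + 1)) +
                  2 * ((D : ℝ) + 1) * (((m : ℝ) / (4 * ((m : ℝ) - 2))) ^ D * X D)))) +
              2 * ((D : ℝ) + 1) * (((H.card : ℝ) ^ 2 / ((n : ℝ) * ((n : ℝ) - 2))) *
                (G * ((T : ℝ) * (((m : ℝ) / (4 * ((m : ℝ) - 2))) ^ D * X D) +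
                  2 * (D : ℝ) * (((m : ℝ) / (4 * ((m : ℝ) - 2))) ^ (D - 1) * X (D - 1)))))))) +
      (2 : ℝ) ^ (D + 1) * (9 * ((t₁ + 2 * (D + 1) + 2 : ℕ) : ℝ) ^ 2 * G) *
        ∑ x ∈ Icc (0 : ℤ) ((t₁ + 2 * (D + 1) + 2 : ℕ) : ℤ) \ B, ∑ j ∈ range (D + 1),
          shellLaw M.2.partner univ H (t₁ + 2 * (D + 1) + 2) (2 * j + 1) x := by
  have h120 := abs_crossingPlane_value_add_newton_le hdes hDT M H ψ hG0 hG lam kap hlam hkap hm hmn X hX0 hX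
  -- the untilted statistic `ψ₀(x) = ψ(x)(2λx+κt)²` is in `[0, 9t²G]` on `[0,t]`
  set t := t₁ + 2 * (D + 1) + 2 with ht
  have hlam1 : |lam| ≤ 1 := hlam
  have hkap1 : |kap| ≤ 1 := hkap
  have hψ₀0 : ∀ x ∈ Icc (0 : ℤ) (t : ℤ), 0 ≤ ψ x * (2 * lam * (x : ℝ) + kap * (t : ℝ)) ^ 2 :=
    fun x hx => mul_nonneg (hψ0 x hx) (sq_nonneg _)
  have hψ₀G : ∀ x ∈ Icc (0 : ℤ) (t : ℤ), ψ x * (2 * lam * (x : ℝ) + kap * (t : ℝ)) ^ 2 ≤ 9 * (t : ℝ) ^ 2 * G := by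
    intro x hx
    have hx0 : (0 : ℝ) ≤ (x : ℝ) := by exact_mod_cast (mem_Icc.1 hx).1
    have hxt : (x : ℝ) ≤ (t : ℝ) := by exact_mod_cast (mem_Icc.1 hx).2
    have hψx : ψ x ≤ G := (le_abs_self _).trans (hG x hx)
    have hA : |2 * lam * (x : ℝ) + kap * (t : ℝ)| ≤ 3 * (t : ℝ) := by
      calc |2 * lam * (x : ℝ) + kap * (t : ℝ)| ≤ |2 * lam * (x : ℝ)| + |kap * (t : ℝ)| := abs_add_le _ _
        _ = 2 * |lam| * (x : ℝ) + |kap| * (t : ℝ) := by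
            rw [abs_mul, abs_mul, abs_mul, abs_of_nonneg hx0, abs_of_nonneg (by positivity : (0 : ℝ) ≤ (t : ℝ)),
              abs_of_nonneg (by norm_num : (0 : ℝ) ≤ 2)]
        _ ≤ 2 * 1 * (t : ℝ) + 1 * (t : ℝ) := by
            have h1 : 2 * |lam| * (x : ℝ) ≤ 2 * 1 * (t : ℝ) :=
              mul_le_mul (mul_le_mul_of_nonneg_left hlam1 (by norm_num)) hxt hx0 (by norm_num)
            have h2 : |kap| * (t : ℝ) ≤ 1 * (t : ℝ) := mul_le_mul_of_nonneg_right hkap1 (by positivity)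
            linarith
        _ = 3 * (t : ℝ) := by ring
    have hsq : (2 * lam * (x : ℝ) + kap * (t : ℝ)) ^ 2 ≤ (3 * (t : ℝ)) ^ 2 := by
      rw [← sq_abs (2 * lam * (x : ℝ) + kap * (t : ℝ))]
      exact pow_le_pow_left₀ (abs_nonneg _) hA 2
    calc ψ x * (2 * lam * (x : ℝ) + kap * (t : ℝ)) ^ 2 ≤ G * (3 * (t : ℝ)) ^ 2 :=
          mul_le_mul hψx hsq (sq_nonneg _) hG0
      _ = 9 * (t : ℝ) ^ 2 * G := by ring
  have h121 := shellProfile_newton_eval_zero_ge (π := M.2.partner) D t H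
    (fun x => ψ x * (2 * lam * (x : ℝ) + kap * (t : ℝ)) ^ 2) hψ₀0 hψ₀G B hB hbulk
  have habs := (abs_le.1 h120).2
  push_cast at h121 habs ⊢
  linarith [h121, habs]

end Summit.PneNP.PneNP.Theorems.ChebyshevTracialDesignCrossingPlaneConditional
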